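/-
Origin: expansion seat `planner-pub-hodgecm-pv03-g7-0`, handover #5 2026-08-18T13:26:22Z (`HOME/pub-hodgecm-pv03-g7/lean/Pv03g7/GenericFactsCM3.lean`, md5 23458843, 130 lines);
landed by the gen-8 packager in gate run 30 as `HodgeCM/Model/ToyG2/GenericFactsCM3.lean` (import ^import Pv03g7\.GenericFactsAll3[ \t]*$→import HodgeCM.Model.ToyG2.GenericFactsAll3 ×1; import ^import Pv03g7\.GysinCM3[ \t]*$→import HodgeCM.Model.ToyG2.GysinCM3 ×1).
-/
/-
# pub-hodgecm-pv03-g7 (DAG-NODE PROVER #03 gen 7) — the eleven generic binders in the CM-good sub-universe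

KERNEL, additive leaf.  Companion of `GenericFactsAll3` (the eleven binders of
`Assembly.COR_CM_of_genericFacts` jointly in `toyUniverse₃ d t`) and `GysinCM3` (transport of F7 / F7d / F2 to full
sub-universes `U.restrictObj Q hQ`).  Here:

* generic transports (`namespace HodgeCM.Universe`, any universe `U`, any closed predicate `Q`) of the remaining
  generic facts to the full sub-universe `U.restrictObj Q hQ` (pv03-g6's `Restrict.lean`): N1 `Fact_cupExterior`
  (via `restrictObj_cupPow` — the iterated cup product of the sub-universe agrees with the ambient one; it is a
  recursive definition, so this is a lemma by induction and not `rfl`), N2 `Fact_cup_hodge`, N3 `Fact_pull_H0`,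
  N4 `Fact_hodge_F0`, F4 `Fact_cupAlg`, F5 `Fact_cupAssoc`, D `Fact_dimProd`, T-CM `Fact_trTopCM`;
* `toyUniverseCM_genericFacts_all (d t) (hd : 1 ≤ d) (ht : t ^ 2 = 16)`: ALL ELEVEN binders of
  `Assembly.COR_CM_of_genericFacts` hold jointly in the CM-good universe `toyUniverseCM d t` (pv03-g6's G4 universe
  of record, `G4WitnessCM` / `G4FinalCM`), and `toyUniverseCM_HC_CM`: its conclusion COR-CM there, obtained by APPLYING
  the assembled theorem;
* `toyUniverseCM_g4_and_genericFacts`: the same universe carries the G4 triple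
  `ModelAxioms ∧ RealisationExistsPerL ∧ RealisationExistsFace` AND the eleven generic binders.

No hypotheses beyond `1 ≤ d`, `t ^ 2 = 16` (needed only for the realisation inputs); nothing cited, posited or
assumed; no statement of the package is edited.  This is a consistency / non-vacuity statement about the package's
OWN hypothesis list in a toy model — it says nothing about complex projective varieties.  Default heartbeats.
-/
import Mathlib
import Summits.HodgeConjecture.HodgeCM.Model.ToyG2.GenericFactsAll3
import Summits.HodgeConjecture.HodgeCM.Model.ToyG2.GysinCM3
import Summits.HodgeConjecture.HodgeCM.Model.ToyG2.G4FinalCM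

/-! PORT of `HodgeCM/Model/ToyG2/GenericFactsCM3.lean` (HodgeCMPerL run 82) — verbatim mechanical port; provenance in the PORT header line. -/

noncomputable section

namespace HodgeCM.Universe

open Literature.AlgebraicGeometry.Motives

variable (U : Universe) {Q : U.Var → Prop} (hQ : U.SubClosed Q)

/-- the iterated cup product `a₀ ∪ ⋯ ∪ a_k` computed in the full sub-universe is the ambient one -/
theorem restrictObj_cupPow (X : (U.restrictObj Q hQ).Var) :
    ∀ (k : ℕ) (a : Fin (k + 1) → U.Coh X.1 1), (U.restrictObj Q hQ).cupPow X k a = U.cupPow X.1 k a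
  | 0, _ => rfl
  | k + 1, a => by
      rw [cupPow_succ, cupPow_succ, restrictObj_cupPow X k]

/-- `CupExterior` (`⋀^{k+1} H¹ ≅ H^{k+1}` via cup) in the sub-universe is the ambient property of the underlying object -/
theorem restrictObj_cupExterior_iff (X : (U.restrictObj Q hQ).Var) (k : ℕ) :
    (U.restrictObj Q hQ).CupExterior X k ↔ U.CupExterior X.1 k := by
  have hc : (U.restrictObj Q hQ).cupPow X k = U.cupPow X.1 k := funext (U.restrictObj_cupPow hQ X k)
  simp only [CupExterior, hc]

/-- N1 transports to the full sub-universe -/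
theorem restrictObj_fact_cupExterior (h : U.Fact_cupExterior) : (U.restrictObj Q hQ).Fact_cupExterior := by
  intro F n Θ k
  rw [restrictObj_cupExterior_iff]
  have h1 : U.CupExterior ((U.restrictObj Q hQ).cmProd F Θ).1 k := by
    rw [cmProd_restrictObj_val]; exact h F n Θ k
  exact h1

/-- N2 transports to the full sub-universe -/
theorem restrictObj_fact_cup_hodge (h : U.Fact_cup_hodge) : (U.restrictObj Q hQ).Fact_cup_hodge := fun X => h X.1

/-- N3 transports to the full sub-universe -/
theorem restrictObj_fact_pull_H0 (h : U.Fact_pull_H0) : (U.restrictObj Q hQ).Fact_pull_H0 := fun X => h X.1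

/-- N4 transports to the full sub-universe -/
theorem restrictObj_fact_hodge_F0 (h : U.Fact_hodge_F0) : (U.restrictObj Q hQ).Fact_hodge_F0 := fun X => h X.1

/-- F4 transports to the full sub-universe -/
theorem restrictObj_fact_cupAlg (h : U.Fact_cupAlg) : (U.restrictObj Q hQ).Fact_cupAlg := fun X => h X.1

/-- F5 transports to the full sub-universe -/
theorem restrictObj_fact_cupAssoc (h : U.Fact_cupAssoc) : (U.restrictObj Q hQ).Fact_cupAssoc := fun X => h X.1

/-- D transports to the full sub-universe -/
theorem restrictObj_fact_dimProd (h : U.Fact_dimProd) : (U.restrictObj Q hQ).Fact_dimProd := fun X Y => h X.1 Y.1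

/-- T-CM transports to the full sub-universe -/
theorem restrictObj_fact_trTopCM (h : U.Fact_trTopCM) : (U.restrictObj Q hQ).Fact_trTopCM := by
  intro F n Θ
  have h1 : Function.Injective
      (U.tr ((U.restrictObj Q hQ).cmProd F Θ).1 (2 * U.dim ((U.restrictObj Q hQ).cmProd F Θ).1)) := by
    rw [cmProd_restrictObj_val]; exact h F n Θ
  exact h1

end HodgeCM.Universe

namespace HodgeCM.ToyG2

open HodgeCM.Toy

variable (d t : ℚ)

/-- **All eleven binders of `Assembly.COR_CM_of_genericFacts`, jointly, in the CM-good universe `toyUniverseCM d t`**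
(`1 ≤ d`, `t² = 16`): `ModelAxioms ∧ RealisationExistsFace ∧ N1 ∧ N2 ∧ N3 ∧ N4 ∧ F4 ∧ F5 ∧ F7 ∧ Fact_dimProd ∧ Fact_trTopCM`. -/
theorem toyUniverseCM_genericFacts_all (hd : 1 ≤ d) (ht : t ^ 2 = 16) :
    (toyUniverseCM d t).ModelAxioms ∧ (toyUniverseCM d t).RealisationExistsFace ∧ (toyUniverseCM d t).Fact_cupExterior ∧
      (toyUniverseCM d t).Fact_cup_hodge ∧ (toyUniverseCM d t).Fact_pull_H0 ∧ (toyUniverseCM d t).Fact_hodge_F0 ∧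
      (toyUniverseCM d t).Fact_cupAlg ∧ (toyUniverseCM d t).Fact_cupAssoc ∧ (toyUniverseCM d t).Fact_gysin ∧
      (toyUniverseCM d t).Fact_dimProd ∧ (toyUniverseCM d t).Fact_trTopCM := by
  obtain ⟨-, -, h1, h2, h3, h4, h5, h6, h7, hdp, htc⟩ := toyUniverse₃_genericFacts_all d t hd ht
  exact ⟨toyUniverseCM_modelAxioms' d t, realisationExistsFaceCM d t hd ht,
    (toyUniverse₃ d t).restrictObj_fact_cupExterior (isCM_subClosed d t) h1,
    (toyUniverse₃ d t).restrictObj_fact_cup_hodge (isCM_subClosed d t) h2,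
    (toyUniverse₃ d t).restrictObj_fact_pull_H0 (isCM_subClosed d t) h3,
    (toyUniverse₃ d t).restrictObj_fact_hodge_F0 (isCM_subClosed d t) h4,
    (toyUniverse₃ d t).restrictObj_fact_cupAlg (isCM_subClosed d t) h5,
    (toyUniverse₃ d t).restrictObj_fact_cupAssoc (isCM_subClosed d t) h6,
    (toyUniverse₃ d t).restrictObj_fact_gysin (isCM_subClosed d t) h7,
    (toyUniverse₃ d t).restrictObj_fact_dimProd (isCM_subClosed d t) hdp,
    (toyUniverse₃ d t).restrictObj_fact_trTopCM (isCM_subClosed d t) htc⟩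

/-- **COR-CM in `toyUniverseCM d t` by the assembled theorem**: `Assembly.COR_CM_of_genericFacts` APPLIED to the eleven
witnesses (`1 ≤ d`, `t² = 16`). -/
theorem toyUniverseCM_HC_CM (hd : 1 ≤ d) (ht : t ^ 2 = 16) : (toyUniverseCM d t).HC_CM := by
  obtain ⟨M, hR, h1, h2, h3, h4, h5, h6, h7, hdp, htc⟩ := toyUniverseCM_genericFacts_all d t hd ht
  exact Assembly.COR_CM_of_genericFacts _ M hR h1 h2 h3 h4 h5 h6 h7 hdp htc

/-- **one CM-good universe for everything**: `toyUniverseCM 1 4` carries the G4 triple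
`ModelAxioms ∧ RealisationExistsPerL ∧ RealisationExistsFace` AND the eleven binders of `Assembly.COR_CM_of_genericFacts`
AND (therefore) COR-CM. -/
theorem toyUniverseCM_g4_and_genericFacts :
    ∃ U : Universe, (U.ModelAxioms ∧ U.RealisationExistsPerL ∧ U.RealisationExistsFace) ∧
      (U.Fact_cupExterior ∧ U.Fact_cup_hodge ∧ U.Fact_pull_H0 ∧ U.Fact_hodge_F0 ∧ U.Fact_cupAlg ∧ U.Fact_cupAssoc ∧
        U.Fact_gysin ∧ U.Fact_dimProd ∧ U.Fact_trTopCM) ∧ U.HC_CM := by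
  obtain ⟨M, hR, hrest⟩ := toyUniverseCM_genericFacts_all 1 4 le_rfl (by norm_num)
  exact ⟨toyUniverseCM 1 4, ⟨M, realisationExistsPerLCM 1 4 le_rfl (by norm_num), hR⟩, hrest,
    toyUniverseCM_HC_CM 1 4 le_rfl (by norm_num)⟩

end HodgeCM.ToyG2

end
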